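import Summits.QuantumFields.BalabanUV.Beta.GAN24.BornLambdaDriftSup
import Summits.QuantumFields.BalabanUV.Beta.GAN24.BornBorderLineage

/-!
# `BalabanUV.Beta.GAN24.BornBorderDrift` — binder row G-an2-4 ∕ (CONV-C), CT-ROUTE (R8°), THE RATE HALF OF THE V-BORN (BORDER) ROW:
# **`hBdev(cVH,0)` — the all-scales Cauchy letter of the unit tables of the V-born remainder `bornSecAt Lc ρ cE cVH 0` — REDUCED TO THE
# TOP LINEAGE AND THE TOP-ALIGNED V PAIR LETTERS**, in both currencies (`LocStencil`; sup-norm), plus the sector sum `hBdev ⟸ hBdev(cVH,0) ∧ hBdev(0,cΛ)`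
# (PART 1, generic `d`: the V twin of leaf-06 g41's `BornLambdaDrift` §1–§2 ∕ `BornLambdaDriftSup` §2; PART 2 = `BornBorderDriftThree` discharges the top
# lineage and the pair `i = 0` at `d = 3` from tree names)

NOT IN PRINT; OUR BOOKKEEPING (G-an2-4 formalisation swarm → CRUX TEAM (2), leaf prover `b2b-balaban-gan24-formalise-leaf-04`, gen 57; journal
`CLAIMS.log` INTENT «BORN-V-DRIFT SOCKET» [LEAF04-G57-INTENT1]).  HONEST FRAMING (cell contract, verbatim): «discharging `BetaPertH` makes Bałaban's UV
stability UNCONDITIONAL — a real constructive-QFT result; it is NOT the continuum limit and NOT the Clay problem.»  HONEST DEPENDENCY (verbatim):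
«continuum YM on T⁴ ⇐ BetaPertH ∧ nine spine estimates (0/9 proved); BetaPertH ⇐ (D1) ∧ (D4) ∧ CAP+tail; G-an2-4 gates asym, D1 and NE2/3/4.»
[folklore] real analysis + bookkeeping over TREE names BY NAME: leaf-06 g41's SECTOR-FREE schema `BornLambdaDrift.exists_consec_of_pairLetters` ∕
`locStencil_allScales_of_consec` and `BornLambdaDriftSup.locStencil_zero_iff_supBound`, road S3's `StencilSlotSupRate.locStencilCauchy_of_uniform_supRate`,
leaf-01 g60's `BornBorderLineage.unitS_bornV_eq_sum` (the V source is THE SAME TABLE `cVH • vhSAt ρ` at every level, so its drift letter is ZERO) and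
`BornLambdaLineage.bornSecAt_add_sectors`; 0 `def`, 0 cited facts, 0 `def … : Prop`, 0 sorry; NO estimate of Bałaban's; discharges NOTHING of (hS, hSall)
on (E): the theorems are SOCKETS whose letters are hypotheses.  NEVER «G-an2-4 closed» as (CONV-C); NOT D1, NOT `BetaPertH`, NOT continuum, NOT Clay.

## The reduction (why the V half needs one letter fewer)
In units the V-born remainder of member `k` is `U_k = V + Σ_{i<k} D(i,k)` (`unitS_bornV_eq_sum`): the SOURCE `V = cVH • vhSAt ρ` — the same finitely supported
border table at every level — plus, per birth level `i < k`, the lineage `D(i,k) = transport (unitStepMap Lc ρ cE) (i+1) (k−1−i) (unitStepMap Lc ρ cE i V)`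
(EXACTLY the object of the capstone's `hCgV` binder).  In leaf-06's schema (`consec_eq`) `F k = V` is CONSTANT, so
`U_{k+1} − U_k = D(0,k+1) + Σ_{i<k} (D(i+1,k+1) − D(i,k))`: the TOP lineage plus the TOP-ALIGNED PAIRS (member `k+1`'s lineage born at `i+1` minus member `k`'s
born at `i`: same transport length `k−1−i`, one more fine level underneath; the pair `i = k−1` is the one-step-image drift).  Letters `CT·(k+1)^p·θT^{k+1}` and
`CP·(k−i)^q·Θ^k` give the all-scales letter (§1, `LocStencil` currency), or — against the UNIFORM letter hB(cVH,0), in the tree from leaf-03's (D) — the same from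
SUP-norm letters by road S3's interpolation (§2).
## Contents
§1 (generic `d`, in-block root) **`exists_hBdevV_of_letters`** (top letter + pairs ⇒ hBdev(cVH,0), `LocStencil` currency); §2 **`exists_hBdevV_of_supLetters`**
(uniform hB(cVH,0) + sup top letter + sup pairs ⇒ hBdev(cVH,0)); §3 **`exists_hBdev_of_sectors`** (hBdev(cVH,cΛ) ⟸ hBdev(cVH,0) ∧ hBdev(0,cΛ), the rate twin of
leaf-01's `exists_hB_of_sectors`; consumes the V ENDs of PART 2 and leaf-06's Λ ENDs BY NAME, whichever closes last).
Unit `b2b-balaban-gan24-formalise-leaf-04` (gen 57), 2026-08-21.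
-/

noncomputable section

open Finset
open scoped BigOperators
open Literature.MathematicalPhysics.QuantumFieldTheory
open Literature.MathematicalPhysics.QuantumFieldTheory.Balaban1983to89
open Literature.MathematicalPhysics.QuantumFieldTheory.Balaban1983to89.Beta
open ExpKernelCalculus (MKer)
open OneStepResolventKernel (Fib LocStencil)
open AffineAveraging (box toSite)
open AveragingHessianKernelsRooted (vhSAt)
open AveragingMixedJetTables (zero_mem_box)
open StepJetData (locStencil_add)
open Summit.QuantumFields.BalabanUV.Beta.HessKerDressedUnits (unitS)
open Summit.QuantumFields.BalabanUV.Beta.GAN24.CombesThomas (sfStep smStep KStepUnit SupBound)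
open Summit.QuantumFields.BalabanUV.Beta.GAN24.StencilSlotOfShapes (locStencil_mono' unitS_add)
open Summit.QuantumFields.BalabanUV.Beta.GAN24.StencilSlotSupRate (locStencilCauchy_of_uniform_supRate)
open Summit.QuantumFields.BalabanUV.Beta.GAN24.SrecWilsonSector (bornSecAt)
open Summit.QuantumFields.BalabanUV.Beta.GAN24.SrecBornSector (unitStepMap)
open Summit.QuantumFields.BalabanUV.Beta.GAN24.AffineUnroll (transport)
open Summit.QuantumFields.BalabanUV.Beta.GAN24.BornLambdaLineage (bornSecAt_add_sectors)
open Summit.QuantumFields.BalabanUV.Beta.GAN24.BornBorderLineage (unitS_bornV_eq_sum)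
open Summit.QuantumFields.BalabanUV.Beta.GAN24.BornLambdaDrift (exists_consec_of_pairLetters locStencil_allScales_of_consec)
open Summit.QuantumFields.BalabanUV.Beta.GAN24.BornLambdaDriftSup (locStencil_zero_iff_supBound locStencil_zero_of_locStencil)

namespace Summit.QuantumFields.BalabanUV.Beta.GAN24.BornBorderDrift

variable {d : ℕ} {Lc : ℕ} [NeZero Lc]

/-! ## §1 The V-born instance of the schema (generic `d`, in-block root): `hBdev(cVH,0)` from two letters, `LocStencil` currency -/

/-- NOT IN PRINT; OUR BOOKKEEPING (generic `d`, in-block root; a SOCKET).  **THE RATE HALF OF THE V-BORN ROW FROM TWO LETTERS**: a TOP-lineage letter `hT`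
(member `k+1`'s lineage born at the finest level: `transport (unitStepMap …) 1 k (unitStepMap … 0 V)`, constant `CT·(k+1)^p·θT^{k+1}`) and the TOP-ALIGNED PAIR
letters `hP` (member `k+1`'s lineage born at `i+1` minus member `k`'s born at `i`: `CP·(k−i)^q·Θ^k`), uniform in the in-block root, give the all-scales Cauchy
letter `LocStencil (U_{k+j} − U_k) (cB·θB^k) δB` of the unit tables of `bornSecAt Lc ρ cE cVH 0` (ONE `cB, θB < 1, δB > 0` for all `k j` and roots).  No
fresh-drift letter is needed: the V source is the same table at every level (leaf-06's schema with `CF = θF = 0`). -/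
theorem exists_hBdevV_of_letters (cE cVH : ℝ) {p q : ℕ}
    (hT : ∃ CT θT δT : ℝ, 0 ≤ CT ∧ 0 ≤ θT ∧ θT < 1 ∧ 0 < δT ∧ ∀ (rr : Fin (d + 1) → ℕ), rr ∈ box (d + 1) Lc → ∀ k : ℕ,
      LocStencil (transport (unitStepMap Lc (toSite rr) cE) 1 k
        (unitStepMap Lc (toSite rr) cE 0 (fun κ u => cVH • vhSAt (toSite rr) d Lc rfl κ u))) (CT * ((((k + 1 : ℕ) : ℝ)) ^ p * θT ^ (k + 1))) δT)
    (hP : ∃ CP Θ δP : ℝ, 0 ≤ CP ∧ 0 ≤ Θ ∧ Θ < 1 ∧ 0 < δP ∧ ∀ (rr : Fin (d + 1) → ℕ), rr ∈ box (d + 1) Lc → ∀ k i : ℕ, i < k →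
      LocStencil
        (transport (unitStepMap Lc (toSite rr) cE) (i + 1 + 1) (k - 1 - i)
            (unitStepMap Lc (toSite rr) cE (i + 1) (fun κ u => cVH • vhSAt (toSite rr) d Lc rfl κ u))
          - transport (unitStepMap Lc (toSite rr) cE) (i + 1) (k - 1 - i)
            (unitStepMap Lc (toSite rr) cE i (fun κ u => cVH • vhSAt (toSite rr) d Lc rfl κ u)))
        (CP * ((((k - i : ℕ) : ℝ)) ^ q * Θ ^ k)) δP) :
    ∃ cB θB δB : ℝ, 0 ≤ cB ∧ 0 ≤ θB ∧ θB < 1 ∧ 0 < δB ∧ ∀ (rr : Fin (d + 1) → ℕ), rr ∈ box (d + 1) Lc → ∀ k j : ℕ,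
      LocStencil (unitS (sfStep Lc (k + j)) (smStep d Lc (k + j)) (bornSecAt Lc (toSite rr) cE cVH 0 (k + j))
        - unitS (sfStep Lc k) (smStep d Lc k) (bornSecAt Lc (toSite rr) cE cVH 0 k)) (cB * θB ^ k) δB := by
  obtain ⟨CT, θT, δT, hCT, hθT0, hθT1, hδT, hT⟩ := hT
  obtain ⟨CP, Θ, δP, hCP, hΘ0, hΘ1, hδP, hP⟩ := hP
  set δ : ℝ := min δT δP with hδdef
  have hδ0 : 0 < δ := lt_min hδT hδP
  have hδT' : δ ≤ δT := min_le_left _ _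
  have hδP' : δ ≤ δP := min_le_right _ _
  -- leaf-06's schema with the ZERO fresh drift (`CF = 0`, `θF = 0`)
  obtain ⟨C, θ, hC, hθ0, hθ1, hschema⟩ :=
    exists_consec_of_pairLetters (d := d) (δ := δ) (p := p) (q := q) (le_refl (0 : ℝ)) (le_refl (0 : ℝ)) zero_lt_one hCT hθT0 hθT1 hCP hΘ0 hΘ1
  have h1θ : 0 < 1 - θ := by linarith
  refine ⟨C / (1 - θ), θ, δ, div_nonneg hC h1θ.le, hθ0.le, hθ1, hδ0, fun rr hrr k j => ?_⟩
  have hF : ∀ k : ℕ, LocStencil ((fun _ : ℕ => fun κ u => cVH • vhSAt (toSite rr) d Lc rfl κ u) (k + 1)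
      - (fun _ : ℕ => fun κ u => cVH • vhSAt (toSite rr) d Lc rfl κ u) k) (0 * (0 : ℝ) ^ k) δ := by
    intro k
    simp only [sub_self, zero_mul]
    intro κ u x y a b
    simp
  have hconsec : ∀ k, LocStencil (unitS (sfStep Lc (k + 1)) (smStep d Lc (k + 1)) (bornSecAt Lc (toSite rr) cE cVH 0 (k + 1))
      - unitS (sfStep Lc k) (smStep d Lc k) (bornSecAt Lc (toSite rr) cE cVH 0 k)) (C * θ ^ k) δ := by
    intro k
    rw [unitS_bornV_eq_sum hrr cE cVH (k + 1), unitS_bornV_eq_sum hrr cE cVH k]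
    refine hschema (fun _ => fun κ u => cVH • vhSAt (toSite rr) d Lc rfl κ u)
      (fun i k => transport (unitStepMap Lc (toSite rr) cE) (i + 1) (k - 1 - i)
        (unitStepMap Lc (toSite rr) cE i (fun κ u => cVH • vhSAt (toSite rr) d Lc rfl κ u)))
      hF (fun k => ?_) (fun k i hik => ?_) k
    · -- the top lineage, raw indices `0 + 1`, `k + 1 - 1 - 0` normalised
      have h := locStencil_mono' (hT rr hrr k) le_rfl hδT'
      rw [show k + 1 - 1 - 0 = k by omega]
      exact h
    · -- the pair, raw index `k + 1 - 1 - (i + 1)` normalised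
      have h := locStencil_mono' (hP rr hrr k i hik) le_rfl hδP'
      rw [show k + 1 - 1 - (i + 1) = k - 1 - i by omega]
      exact h
  exact locStencil_allScales_of_consec (U := fun k => unitS (sfStep Lc k) (smStep d Lc k) (bornSecAt Lc (toSite rr) cE cVH 0 k))
    hC hθ0.le hθ1 hconsec k j

/-! ## §2 The same in SUP-norm currency against the uniform letter hB(cVH,0) (generic `d`, in-block root) -/

/-- NOT IN PRINT; OUR BOOKKEEPING (generic `d`, in-block root; a SOCKET).  **THE RATE HALF OF THE V-BORN ROW FROM A UNIFORM LETTER AND TWO SUP-NORM LETTERS**: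
the `k`-uniform local-stencil letter `hB` of the unit tables `U_k` of `bornSecAt Lc ρ cE cVH 0` (one `CB, δB > 0` for all roots and levels), a top-lineage SUP
letter `CT·(k+1)^p·θT^{k+1}` and top-aligned pair SUP letters `CP·(k−i)^q·Θ^k` (entrywise, NO decay asked) give the all-scales Cauchy letter
`LocStencil (U_{k+j} − U_k) (cB·θB^k) (δB∕2)` — leaf-06's schema at locality rate `0`, then road S3's `locStencilCauchy_of_uniform_supRate` (`θB = √θ`). -/
theorem exists_hBdevV_of_supLetters (cE cVH : ℝ) {p q : ℕ}
    (hB : ∃ CB δB : ℝ, 0 < δB ∧ ∀ (rr : Fin (d + 1) → ℕ), rr ∈ box (d + 1) Lc →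
      ∀ k : ℕ, LocStencil (unitS (sfStep Lc k) (smStep d Lc k) (bornSecAt Lc (toSite rr) cE cVH 0 k)) CB δB)
    (hT : ∃ CT θT : ℝ, 0 ≤ CT ∧ 0 ≤ θT ∧ θT < 1 ∧ ∀ (rr : Fin (d + 1) → ℕ), rr ∈ box (d + 1) Lc → ∀ (k : ℕ) κ u,
      SupBound (transport (unitStepMap Lc (toSite rr) cE) 1 k
        (unitStepMap Lc (toSite rr) cE 0 (fun κ u => cVH • vhSAt (toSite rr) d Lc rfl κ u)) κ u) (CT * ((((k + 1 : ℕ) : ℝ)) ^ p * θT ^ (k + 1))))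
    (hP : ∃ CP Θ : ℝ, 0 ≤ CP ∧ 0 ≤ Θ ∧ Θ < 1 ∧ ∀ (rr : Fin (d + 1) → ℕ), rr ∈ box (d + 1) Lc → ∀ k i : ℕ, i < k → ∀ κ u,
      SupBound
        ((transport (unitStepMap Lc (toSite rr) cE) (i + 1 + 1) (k - 1 - i)
            (unitStepMap Lc (toSite rr) cE (i + 1) (fun κ u => cVH • vhSAt (toSite rr) d Lc rfl κ u))
          - transport (unitStepMap Lc (toSite rr) cE) (i + 1) (k - 1 - i)
            (unitStepMap Lc (toSite rr) cE i (fun κ u => cVH • vhSAt (toSite rr) d Lc rfl κ u))) κ u)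
        (CP * ((((k - i : ℕ) : ℝ)) ^ q * Θ ^ k))) :
    ∃ cB θB δB : ℝ, 0 ≤ cB ∧ 0 ≤ θB ∧ θB < 1 ∧ 0 < δB ∧ ∀ (rr : Fin (d + 1) → ℕ), rr ∈ box (d + 1) Lc → ∀ k j : ℕ,
      LocStencil (unitS (sfStep Lc (k + j)) (smStep d Lc (k + j)) (bornSecAt Lc (toSite rr) cE cVH 0 (k + j))
        - unitS (sfStep Lc k) (smStep d Lc k) (bornSecAt Lc (toSite rr) cE cVH 0 k)) (cB * θB ^ k) δB := by
  obtain ⟨CB, δB, hδB, hB⟩ := hB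
  obtain ⟨CT, θT, hCT, hθT0, hθT1, hT⟩ := hT
  obtain ⟨CP, Θ, hCP, hΘ0, hΘ1, hP⟩ := hP
  -- leaf-06's schema at locality rate 0 = the one-step SUP rate of `U`, with the zero fresh drift
  obtain ⟨c, θ, hc, hθ0, hθ1, hschema⟩ :=
    exists_consec_of_pairLetters (d := d) (δ := 0) (p := p) (q := q) (le_refl (0 : ℝ)) (le_refl (0 : ℝ)) zero_lt_one hCT hθT0 hθT1 hCP hΘ0 hΘ1
  have hroot : (fun _ : Fin (d + 1) => (0 : ℕ)) ∈ box (d + 1) Lc := zero_mem_box (Nat.one_le_iff_ne_zero.2 (NeZero.ne Lc))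
  have hCB : 0 ≤ CB := ((hB _ hroot 0) 0 0).nonneg (Sum.inl 0)
  have h1θ : 0 < 1 - θ := by linarith
  refine ⟨Real.sqrt (2 * (c / (1 - θ)) * CB), Real.sqrt θ, δB / 2, Real.sqrt_nonneg _, Real.sqrt_nonneg _,
    (Real.sqrt_lt' one_pos).2 (by rwa [one_pow]), by positivity, fun rr hrr k j => ?_⟩
  have hF : ∀ k : ℕ, LocStencil ((fun _ : ℕ => fun κ u => cVH • vhSAt (toSite rr) d Lc rfl κ u) (k + 1)
      - (fun _ : ℕ => fun κ u => cVH • vhSAt (toSite rr) d Lc rfl κ u) k) (0 * (0 : ℝ) ^ k) 0 := by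
    intro k
    simp only [sub_self, zero_mul]
    intro κ u x y a b
    simp
  -- the one-step sup rate at this root
  have hrate : ∀ (n : ℕ) κ u, SupBound (unitS (sfStep Lc (n + 1)) (smStep d Lc (n + 1)) (bornSecAt Lc (toSite rr) cE cVH 0 (n + 1)) κ u
      - unitS (sfStep Lc n) (smStep d Lc n) (bornSecAt Lc (toSite rr) cE cVH 0 n) κ u) (c * θ ^ n) := by
    intro n
    have h0 : LocStencil (unitS (sfStep Lc (n + 1)) (smStep d Lc (n + 1)) (bornSecAt Lc (toSite rr) cE cVH 0 (n + 1))
        - unitS (sfStep Lc n) (smStep d Lc n) (bornSecAt Lc (toSite rr) cE cVH 0 n)) (c * θ ^ n) 0 := by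
      rw [unitS_bornV_eq_sum hrr cE cVH (n + 1), unitS_bornV_eq_sum hrr cE cVH n]
      refine hschema (fun _ => fun κ u => cVH • vhSAt (toSite rr) d Lc rfl κ u)
        (fun i k => transport (unitStepMap Lc (toSite rr) cE) (i + 1) (k - 1 - i)
          (unitStepMap Lc (toSite rr) cE i (fun κ u => cVH • vhSAt (toSite rr) d Lc rfl κ u)))
        hF (fun k => ?_) (fun k i hik => ?_) n
      · have h := locStencil_zero_iff_supBound.2 (hT rr hrr k)
        rw [show k + 1 - 1 - 0 = k by omega]
        exact h
      · have h := locStencil_zero_iff_supBound.2 (hP rr hrr k i hik)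
        rw [show k + 1 - 1 - (i + 1) = k - 1 - i by omega]
        exact h
    intro κ u
    exact (locStencil_zero_iff_supBound.1 h0) κ u
  exact locStencilCauchy_of_uniform_supRate (F := fun n => unitS (sfStep Lc n) (smStep d Lc n) (bornSecAt Lc (toSite rr) cE cVH 0 n))
    (fun n => hB rr hrr n) hrate hc hθ0.le hθ1 k j

/-! ## §3 The sector sum for the rate letter (generic `d`, in-block root) -/

/-- NOT IN PRINT; OUR BOOKKEEPING (generic `d`, in-block root; [folklore]).  **THE RATE LETTER OF THE BORN ROW FROM ITS TWO SECTORS**: `bornSecAt Lc ρ cE cVH cΛ`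
is the V-born remainder (`cΛ := 0`) plus the Λ-born remainder (`cVH := 0`) (leaf-01's `bornSecAt_add_sectors`, the units map is additive), so the all-scales
Cauchy letters hBdev(cVH,0) and hBdev(0,cΛ) give hBdev(cVH,cΛ) (constants added, `θ = max`, `δ = min`) — the rate twin of leaf-01's `exists_hB_of_sectors`;
it consumes the ENDs of this file and of leaf-06's `BornLambdaDrift(Sup)` BY NAME, whichever closes last. -/
theorem exists_hBdev_of_sectors (cE cVH cΛ : ℝ)
    (hV : ∃ cB θB δB : ℝ, 0 ≤ cB ∧ 0 ≤ θB ∧ θB < 1 ∧ 0 < δB ∧ ∀ (rr : Fin (d + 1) → ℕ), rr ∈ box (d + 1) Lc → ∀ k j : ℕ,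
      LocStencil (unitS (sfStep Lc (k + j)) (smStep d Lc (k + j)) (bornSecAt Lc (toSite rr) cE cVH 0 (k + j))
        - unitS (sfStep Lc k) (smStep d Lc k) (bornSecAt Lc (toSite rr) cE cVH 0 k)) (cB * θB ^ k) δB)
    (hL : ∃ cB θB δB : ℝ, 0 ≤ cB ∧ 0 ≤ θB ∧ θB < 1 ∧ 0 < δB ∧ ∀ (rr : Fin (d + 1) → ℕ), rr ∈ box (d + 1) Lc → ∀ k j : ℕ,
      LocStencil (unitS (sfStep Lc (k + j)) (smStep d Lc (k + j)) (bornSecAt Lc (toSite rr) cE 0 cΛ (k + j))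
        - unitS (sfStep Lc k) (smStep d Lc k) (bornSecAt Lc (toSite rr) cE 0 cΛ k)) (cB * θB ^ k) δB) :
    ∃ cB θB δB : ℝ, 0 ≤ cB ∧ 0 ≤ θB ∧ θB < 1 ∧ 0 < δB ∧ ∀ (rr : Fin (d + 1) → ℕ), rr ∈ box (d + 1) Lc → ∀ k j : ℕ,
      LocStencil (unitS (sfStep Lc (k + j)) (smStep d Lc (k + j)) (bornSecAt Lc (toSite rr) cE cVH cΛ (k + j))
        - unitS (sfStep Lc k) (smStep d Lc k) (bornSecAt Lc (toSite rr) cE cVH cΛ k)) (cB * θB ^ k) δB := by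
  obtain ⟨cV, θV, δV, hcV, hθV0, hθV1, hδV, hV⟩ := hV
  obtain ⟨cL, θL, δL, hcL, hθL0, hθL1, hδL, hL⟩ := hL
  set θ : ℝ := max θV θL with hθ
  have hθ0 : 0 ≤ θ := le_max_of_le_left hθV0
  have hθ1 : θ < 1 := max_lt hθV1 hθL1
  refine ⟨cV + cL, θ, min δV δL, by positivity, hθ0, hθ1, lt_min hδV hδL, fun rr hrr k j => ?_⟩
  have e : ∀ n : ℕ, unitS (sfStep Lc n) (smStep d Lc n) (bornSecAt Lc (toSite rr) cE cVH cΛ n) = fun κ u =>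
      unitS (sfStep Lc n) (smStep d Lc n) (bornSecAt Lc (toSite rr) cE cVH 0 n) κ u
        + unitS (sfStep Lc n) (smStep d Lc n) (bornSecAt Lc (toSite rr) cE 0 cΛ n) κ u := by
    intro n
    rw [bornSecAt_add_sectors hrr cE cVH cΛ n]
    exact unitS_add _ _ _ _
  have e2 : unitS (sfStep Lc (k + j)) (smStep d Lc (k + j)) (bornSecAt Lc (toSite rr) cE cVH cΛ (k + j))
        - unitS (sfStep Lc k) (smStep d Lc k) (bornSecAt Lc (toSite rr) cE cVH cΛ k)
      = (unitS (sfStep Lc (k + j)) (smStep d Lc (k + j)) (bornSecAt Lc (toSite rr) cE cVH 0 (k + j))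
          - unitS (sfStep Lc k) (smStep d Lc k) (bornSecAt Lc (toSite rr) cE cVH 0 k))
        + (unitS (sfStep Lc (k + j)) (smStep d Lc (k + j)) (bornSecAt Lc (toSite rr) cE 0 cΛ (k + j))
          - unitS (sfStep Lc k) (smStep d Lc k) (bornSecAt Lc (toSite rr) cE 0 cΛ k)) := by
    rw [e (k + j), e k]
    funext κ u x y a b
    simp only [Pi.add_apply, Pi.sub_apply]
    ring
  rw [e2]
  have h1 := hV rr hrr k j
  have h2 := hL rr hrr k j
  have hp1 : cV * θV ^ k ≤ cV * θ ^ k := mul_le_mul_of_nonneg_left (pow_le_pow_left₀ hθV0 (le_max_left _ _) k) hcV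
  have hp2 : cL * θL ^ k ≤ cL * θ ^ k := mul_le_mul_of_nonneg_left (pow_le_pow_left₀ hθL0 (le_max_right _ _) k) hcL
  have h := locStencil_add (locStencil_mono' h1 hp1 (min_le_left δV δL)) (locStencil_mono' h2 hp2 (min_le_right δV δL))
  exact locStencil_mono' h (le_of_eq (by ring)) le_rfl

end Summit.QuantumFields.BalabanUV.Beta.GAN24.BornBorderDrift

end
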